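import Summits.KontsevichZagierPeriods.KontsevichZagierPeriods.Theorems.RootDecompQuadraticDescentPair18HomotopyP09

/-! # `RootDecompQuadraticDescentPair18HomotopyP10` — part 10/31 of the mechanical ≤400-line split of `Pair18Homotopy_v14_noguard.lean` (sha256 72e9c8442b4af820…)
Source: decomp-kz lens-6 g9 `Pair18Homotopy.lean` v14 (HOME/decomp-kz-lens-6/g9/, sha256 3dda3232…; critic g4-48/g4-53/g4-56/g5 CLEARED; census pair #18 of crux stmt-KontsevichZagierPeriods-28994: homotopy cells, duplications, inversions, Euler–Landen, arc/angle regions; terminal `pair18_g8strips_of_grid : hEuler → hGrid → hAng4 → (g8 form of #18)`); `#guard_msgs … #print axioms` pins removed for landing.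
Split by census-1 g9 `gen/splitlean.py`: scopes re-opened with their `open`/`variable`/`set_option` context; mathematics and declaration order unchanged. -/

set_option linter.unusedSimpArgs false
noncomputable section
open _root_.Set MvPolynomial
namespace Summit.KontsevichZagierPeriods.RootDecompQuadraticDescent.Pair18Homotopy
open Literature.NumberTheory.Transcendental
open Literature.NumberTheory.Transcendental.KZ (RFun cube)
open Summit.KontsevichZagierPeriods.RootDecompQuadraticDescent.DarkPairs (rel_reflect_rep rel_double)
/-- Auxiliary step `vec2_1` (§2b): vec2 1. [bookkeeping] -/
private theorem vec2_1 (a b : ℝ) : (![a, b] : Fin 2 → ℝ) 1 = b := rfl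

/-- Auxiliary step `vec2_0` (§2b): vec2 0. [bookkeeping] -/
private theorem vec2_0 (a b : ℝ) : (![a, b] : Fin 2 → ℝ) 0 = a := rfl

/-- Linearity in the integrand (rule 1b): `T = S + U` pointwise on the square. -/
private theorem rel_lin (T S U : RFun 2) (h : ∀ x ∈ cube 2, T.fn x = S.fn x + U.fn x) :
    KZ.of T.rep - KZ.of S.rep - KZ.of U.rep ∈ KZ.relations :=
  KZ.cubicalLinGens_subset_relations (KZ.mem_cubicalLinGens T.isTameCube_rep S.isTameCube_rep
    U.isTameCube_rep fun x hx => by simpa using h x hx)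

/-- Auxiliary step `cube2` (§0): cube2. [bookkeeping] -/
private theorem cube2 {x : Fin 2 → ℝ} (hx : x ∈ KZ.cube 2) : (0 ≤ x 0 ∧ x 0 ≤ 1) ∧ (0 ≤ x 1 ∧ x 1 ≤ 1) := ⟨hx 0, hx 1⟩

section Inv0
open Literature.ModelTheory.ExponentialFields (IsSemialgebraic isSemialgebraic_setOf_eval_le)

/-- `[Bv] ≡ [M|ΩB]` via `(v,t) ↦ ((t+v)/2, t)` (`w = m + v`). -/
theorem Bv_cov : KZ.of Bv.rep - KZ.of MΩB ∈ KZ.relations := by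
  let Φ : (Fin 2 → ℝ) → (Fin 2 → ℝ) := fun z => ![2⁻¹ * (z 1 + z 0), z 1]
  let Mz : (Fin 2 → ℝ) → Matrix (Fin 2) (Fin 2) ℝ := fun _ => !![1 / 2, 1 / 2; 0, 1]
  let Φ' : (Fin 2 → ℝ) → (Fin 2 → ℝ) →L[ℝ] (Fin 2 → ℝ) := fun z =>
    LinearMap.toContinuousLinearMap (Matrix.toLin' (Mz z))
  have hΦ'ap : ∀ z w, Φ' z w = ![1 / 2 * w 0 + 1 / 2 * w 1, w 1] := by
    intro z w; funext i
    fin_cases i <;> simp [Φ', Mz, Matrix.toLin'_apply, Matrix.mulVec, dotProduct, Fin.sum_univ_two]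
  have hdet : ∀ z, (Φ' z).det = 1 / 2 := by
    intro z
    unfold ContinuousLinearMap.det
    simp [Φ', LinearMap.det_toLin', Mz, Matrix.det_fin_two]
  have hdom : MΩB.domain = Φ '' Bv.rep.domain := by
    rw [RFun.rep_domain]
    simp only [MΩB, KZ.IntegralRep.domain_restrict]
    ext w
    constructor
    · rintro ⟨⟨hw, hle⟩, hge⟩
      simp only [mem_setOf_eq] at hle hge
      have hw0 := (hw 0).1
      have hw1 := (hw 1).1
      refine ⟨![2 * w 0 - w 1, w 1], ?_, ?_⟩
      · intro i
        fin_cases i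
        · exact ⟨by simp; linarith, by simp; linarith⟩
        · exact hw 1
      · funext i
        fin_cases i
        · simp [Φ]; try ring
        · simp [Φ]
    · rintro ⟨z, hz, rfl⟩
      have hz0 := (hz 0).1
      have hz0' := (hz 0).2
      have hz1 := (hz 1).1
      have hz1' := (hz 1).2
      refine ⟨⟨fun i => ?_, ?_⟩, ?_⟩
      · fin_cases i
        · exact ⟨by simp [Φ]; positivity, by simp [Φ]; linarith⟩
        · simpa [Φ] using hz 1
      · simp only [mem_setOf_eq, Φ, vec2_0, vec2_1, Matrix.cons_val_zero, Matrix.cons_val_one, Matrix.head_cons]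
        linarith
      · simp only [mem_setOf_eq, Φ, vec2_0, vec2_1, Matrix.cons_val_zero, Matrix.cons_val_one, Matrix.head_cons]
        linarith
  refine KZ.changeOfVariablesRel_subset_relations ⟨2, Bv.rep, MΩB, Φ, Φ', ?_, ?_, ?_, hdom, ?_, rfl⟩
  · refine (isSemialgebraicMapOn_iff_forall_holds Bv.rep.isSemialgebraic_domain).mpr fun i => ?_
    fin_cases i
    · exact (isSemialgebraicFunOn_aeval Bv.rep.isSemialgebraic_domain (C (1 / 2) * (X 1 + X 0))).congr
        fun z _ => by simp [Φ, map_add, map_sub, map_mul, map_pow, map_neg, aeval_C, aeval_X, map_one, map_ofNat, eq_ratCast, Rat.cast_one, Rat.cast_ofNat, Rat.cast_div, Rat.cast_neg, vec2_0, vec2_1, Matrix.cons_val_zero, Matrix.cons_val_one, Matrix.head_cons]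
    · exact (isSemialgebraicFunOn_aeval Bv.rep.isSemialgebraic_domain (X 1)).congr fun z _ => by simp [Φ]
  · intro z hz
    have h0 : HasFDerivAt (fun w : Fin 2 → ℝ => 2⁻¹ * (w 1 + w 0))
        ((2⁻¹ : ℝ) • (ContinuousLinearMap.proj (R := ℝ) (φ := fun _ : Fin 2 => ℝ) 1 +
          ContinuousLinearMap.proj (R := ℝ) (φ := fun _ : Fin 2 => ℝ) 0)) z :=
      ((hasFDerivAt_apply (𝕜 := ℝ) 1 z).add (hasFDerivAt_apply (𝕜 := ℝ) 0 z)).const_mul 2⁻¹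
    have h1 : HasFDerivAt (fun w : Fin 2 → ℝ => w 1)
        (ContinuousLinearMap.proj (R := ℝ) (φ := fun _ : Fin 2 => ℝ) 1) z := hasFDerivAt_apply 1 z
    have hpi : HasFDerivAt Φ (Φ' z) z := by
      rw [hasFDerivAt_pi']
      intro i
      fin_cases i
      · have e : (ContinuousLinearMap.proj (R := ℝ) (φ := fun _ : Fin 2 => ℝ) 0).comp (Φ' z) =
            (2⁻¹ : ℝ) • (ContinuousLinearMap.proj (R := ℝ) (φ := fun _ : Fin 2 => ℝ) 1 +
              ContinuousLinearMap.proj (R := ℝ) (φ := fun _ : Fin 2 => ℝ) 0) := by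
          ext w; simp [hΦ'ap]; try ring
        simpa [e, Φ, Function.comp_def] using h0
      · have e : (ContinuousLinearMap.proj (R := ℝ) (φ := fun _ : Fin 2 => ℝ) 1).comp (Φ' z) =
            ContinuousLinearMap.proj (R := ℝ) (φ := fun _ : Fin 2 => ℝ) 1 := by
          ext w; simp [hΦ'ap]
        simpa [e, Φ] using h1
    exact hpi.hasFDerivWithinAt
  · intro z₁ hz₁ z₂ hz₂ heq
    have e1 : z₁ 1 = z₂ 1 := by simpa [Φ] using congrFun heq 1
    have e0 : 2⁻¹ * (z₁ 1 + z₁ 0) = 2⁻¹ * (z₂ 1 + z₂ 0) := by simpa [Φ] using congrFun heq 0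
    have e0' : z₁ 0 = z₂ 0 := by linarith
    funext i
    fin_cases i
    · exact e0'
    · exact e1
  · intro z hz
    have hz0 : (0 : ℝ) ≤ z 0 := (hz 0).1
    have hz1 : (0 : ℝ) ≤ z 1 := (hz 1).1
    have hp : (0 : ℝ) < 1 + z 1 := by linarith
    have hq : (0 : ℝ) < 1 + z 1 + z 0 := by linarith
    rw [hdet z, RFun.rep_integrand, abs_of_pos (by positivity)]
    simp only [MΩB, KZ.IntegralRep.integrand_restrict, RFun.rep_integrand]
    simp only [Bv, Mst, BvDen, MstDen, RFun.fn, Φ, map_add, map_sub, map_mul, map_pow, map_neg, aeval_C, aeval_X, map_one, map_ofNat, eq_ratCast, Rat.cast_one, Rat.cast_ofNat, Rat.cast_div, Rat.cast_neg, vec2_0, vec2_1, Matrix.cons_val_zero, Matrix.cons_val_one, Matrix.head_cons]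
    field_simp
    ring

/-- **symmetry `w ↔ m`**: `[M|T′] ≡ [M|T]` via `(w̃,t) ↦ (t/2, 2w̃)`. -/
theorem T'_cov : KZ.of MT' - KZ.of MT ∈ KZ.relations := by
  let Φ : (Fin 2 → ℝ) → (Fin 2 → ℝ) := fun z => ![2⁻¹ * z 1, 2 * z 0]
  let Mz : (Fin 2 → ℝ) → Matrix (Fin 2) (Fin 2) ℝ := fun _ => !![0, 1 / 2; 2, 0]
  let Φ' : (Fin 2 → ℝ) → (Fin 2 → ℝ) →L[ℝ] (Fin 2 → ℝ) := fun z =>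
    LinearMap.toContinuousLinearMap (Matrix.toLin' (Mz z))
  have hΦ'ap : ∀ z w, Φ' z w = ![1 / 2 * w 1, 2 * w 0] := by
    intro z w; funext i
    fin_cases i <;> simp [Φ', Mz, Matrix.toLin'_apply, Matrix.mulVec, dotProduct, Fin.sum_univ_two]
  have hdet : ∀ z, (Φ' z).det = -1 := by
    intro z
    unfold ContinuousLinearMap.det
    simp [Φ', LinearMap.det_toLin', Mz, Matrix.det_fin_two]
  have hdom : MT.domain = Φ '' MT'.domain := by
    simp only [MT, MT', KZ.IntegralRep.domain_restrict]
    ext w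
    constructor
    · rintro ⟨hw, hle⟩
      simp only [mem_setOf_eq] at hle
      have hw0 := (hw 0).1
      have hw1 := (hw 1).1
      have hw1' := (hw 1).2
      refine ⟨![2⁻¹ * w 1, 2 * w 0], ⟨⟨?_, ?_⟩, ?_⟩, ?_⟩
      · intro i
        fin_cases i
        · exact ⟨by simp; linarith, by simp; linarith⟩
        · exact ⟨by simp; linarith, by simp; linarith⟩
      · simp; linarith
      · simp only [mem_setOf_eq, vec2_0, vec2_1, Matrix.cons_val_zero, Matrix.cons_val_one, Matrix.head_cons]
        linarith
      · funext i
        fin_cases i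
        · simp [Φ]
        · simp [Φ]
    · rintro ⟨z, ⟨⟨hz, hhalf⟩, hle⟩, rfl⟩
      simp only [mem_setOf_eq] at hle
      have hz0 := (hz 0).1
      have hz1 := (hz 1).1
      have hz1' := (hz 1).2
      refine ⟨fun i => ?_, ?_⟩
      · fin_cases i
        · exact ⟨by simp [Φ]; linarith, by simp [Φ]; linarith⟩
        · exact ⟨by simp [Φ]; linarith, by simp [Φ]; linarith⟩
      · simp only [mem_setOf_eq, Φ, vec2_0, vec2_1, Matrix.cons_val_zero, Matrix.cons_val_one, Matrix.head_cons]
        linarith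
  refine KZ.changeOfVariablesRel_subset_relations ⟨2, MT', MT, Φ, Φ', ?_, ?_, ?_, hdom, ?_, rfl⟩
  · have hsd : IsSemialgebraic ℚ MT'.domain := MT'.isSemialgebraic_domain
    refine (isSemialgebraicMapOn_iff_forall_holds hsd).mpr fun i => ?_
    fin_cases i
    · exact (isSemialgebraicFunOn_aeval hsd (C (1 / 2) * X 1)).congr fun z _ => by simp [Φ, map_add, map_sub, map_mul, map_pow, map_neg, aeval_C, aeval_X, map_one, map_ofNat, eq_ratCast, Rat.cast_one, Rat.cast_ofNat, Rat.cast_div, Rat.cast_neg, vec2_0, vec2_1, Matrix.cons_val_zero, Matrix.cons_val_one, Matrix.head_cons]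
    · exact (isSemialgebraicFunOn_aeval hsd (C 2 * X 0)).congr fun z _ => by simp [Φ, map_add, map_sub, map_mul, map_pow, map_neg, aeval_C, aeval_X, map_one, map_ofNat, eq_ratCast, Rat.cast_one, Rat.cast_ofNat, Rat.cast_div, Rat.cast_neg, vec2_0, vec2_1, Matrix.cons_val_zero, Matrix.cons_val_one, Matrix.head_cons]
  · intro z hz
    have h0 : HasFDerivAt (fun w : Fin 2 → ℝ => 2⁻¹ * w 1)
        ((2⁻¹ : ℝ) • ContinuousLinearMap.proj (R := ℝ) (φ := fun _ : Fin 2 => ℝ) 1) z :=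
      (hasFDerivAt_apply (𝕜 := ℝ) 1 z).const_mul 2⁻¹
    have h1 : HasFDerivAt (fun w : Fin 2 → ℝ => 2 * w 0)
        ((2 : ℝ) • ContinuousLinearMap.proj (R := ℝ) (φ := fun _ : Fin 2 => ℝ) 0) z :=
      (hasFDerivAt_apply (𝕜 := ℝ) 0 z).const_mul 2
    have hpi : HasFDerivAt Φ (Φ' z) z := by
      rw [hasFDerivAt_pi']
      intro i
      fin_cases i
      · have e : (ContinuousLinearMap.proj (R := ℝ) (φ := fun _ : Fin 2 => ℝ) 0).comp (Φ' z) =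
            (2⁻¹ : ℝ) • ContinuousLinearMap.proj (R := ℝ) (φ := fun _ : Fin 2 => ℝ) 1 := by
          ext w; simp [hΦ'ap]
        simpa [e, Φ, Function.comp_def] using h0
      · have e : (ContinuousLinearMap.proj (R := ℝ) (φ := fun _ : Fin 2 => ℝ) 1).comp (Φ' z) =
            (2 : ℝ) • ContinuousLinearMap.proj (R := ℝ) (φ := fun _ : Fin 2 => ℝ) 0 := by
          ext w; simp [hΦ'ap]
        simpa [e, Φ, Function.comp_def] using h1
    exact hpi.hasFDerivWithinAt
  · intro z₁ hz₁ z₂ hz₂ heq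
    have e1 : 2⁻¹ * z₁ 1 = 2⁻¹ * z₂ 1 := by simpa [Φ] using congrFun heq 0
    have e0 : 2 * z₁ 0 = 2 * z₂ 0 := by simpa [Φ] using congrFun heq 1
    have e0' : z₁ 0 = z₂ 0 := by linarith
    have e1' : z₁ 1 = z₂ 1 := by linarith
    funext i
    fin_cases i
    · exact e0'
    · exact e1'
  · intro z hz
    have hz0 : (0 : ℝ) ≤ z 0 := (hz.1.1 0).1
    have hz1 : (0 : ℝ) ≤ z 1 := (hz.1.1 1).1
    have hp : (0 : ℝ) < 1 + z 1 := by linarith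
    have hq : (0 : ℝ) < 1 + 2 * z 0 := by linarith
    rw [hdet z]
    simp only [MT, MT', KZ.IntegralRep.integrand_restrict, RFun.rep_integrand, abs_neg, abs_one, mul_one]
    simp only [Mst, MstDen, RFun.fn, Φ, map_add, map_sub, map_mul, map_pow, map_neg, aeval_C, aeval_X, map_one, map_ofNat, eq_ratCast, Rat.cast_one, Rat.cast_ofNat, Rat.cast_div, Rat.cast_neg, vec2_0, vec2_1, Matrix.cons_val_zero, Matrix.cons_val_one, Matrix.head_cons]
    ring_nf

/-- `[Lhalf] ≡ [M|lower half]` (the dyadic rescaling `w̃ = w'/2`). -/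
theorem Lhalf_cov : KZ.of Lhalf.rep - KZ.of MQ ∈ KZ.relations := by
  refine KZ.changeOfVariablesRel_subset_relations
    ⟨2, Lhalf.rep, MQ, KZ.lowerHalfMap 0, fun _ => KZ.halfScaleCLM 0, ?_, ?_, ?_, ?_, ?_, rfl⟩
  · exact KZ.isSemialgebraicMapOn_lowerHalfMap 0
  · exact fun x _ => KZ.hasFDerivWithinAt_lowerHalfMap 0 _ x
  · exact (KZ.lowerHalfMap_injective 0).injOn
  · simp only [MQ, KZ.IntegralRep.domain_restrict, RFun.rep_domain, KZ.image_lowerHalfMap_cube]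
  · intro x hx
    have hx0 : (0 : ℝ) ≤ x 0 := (hx 0).1
    have hx1 : (0 : ℝ) ≤ x 1 := (hx 1).1
    have hp : (0 : ℝ) < 1 + x 1 := by linarith
    have hq : (0 : ℝ) < 1 + x 0 := by linarith
    rw [KZ.det_halfScaleCLM, abs_of_pos (by norm_num : (0 : ℝ) < 1 / 2)]
    simp only [MQ, KZ.IntegralRep.integrand_restrict, RFun.rep_integrand]
    simp only [Lhalf, Mst, LhalfDen, MstDen, RFun.fn, KZ.lowerHalfMap, Function.update_self,
      Function.update_of_ne (show (1 : Fin 2) ≠ 0 by decide), map_add, map_sub, map_mul, map_pow, map_neg, aeval_C, aeval_X, map_one, map_ofNat, eq_ratCast, Rat.cast_one, Rat.cast_ofNat, Rat.cast_div, Rat.cast_neg, vec2_0, vec2_1, Matrix.cons_val_zero, Matrix.cons_val_one, Matrix.head_cons]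
    field_simp

/-- `[Lbox] ≡ 2•[Lhalf]`. -/
theorem Lbox_half : KZ.of Lbox.rep - 2 • KZ.of Lhalf.rep ∈ KZ.relations := by
  refine rel_nsmul 2 Lbox Lhalf fun z hz => ?_
  have hz0 : (0 : ℝ) ≤ z 0 := (hz 0).1
  have hz1 : (0 : ℝ) ≤ z 1 := (hz 1).1
  have hp : (0 : ℝ) < 1 + z 1 := by linarith
  have hq : (0 : ℝ) < 1 + z 0 := by linarith
  simp only [Lbox, Lhalf, LboxDen, LhalfDen, RFun.fn, Nat.cast_ofNat, map_add, map_sub, map_mul, map_pow, map_neg, aeval_C, aeval_X, map_one, map_ofNat, eq_ratCast, Rat.cast_one, Rat.cast_ofNat, Rat.cast_div, Rat.cast_neg, vec2_0, vec2_1, Matrix.cons_val_zero, Matrix.cons_val_one, Matrix.head_cons]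
  field_simp

/-- **The inversion junk evaluated by moves**: `4·([E0] + [Ax1] − [U1]) ≡ [Lbox]` (`= log²2`), i.e.
`Θ(0,½) + Θ(0,2) − 2Θ(0,1) = ¼ log²2` as a congruence of boxes. [cite: KontsevichZagier2001, §1.2] -/
theorem inv0_rel : 4 • (KZ.of E0.rep + KZ.of Ax1.rep - KZ.of U1.rep) - KZ.of Lbox.rep ∈ KZ.relations := by
  have e : 4 • (KZ.of E0.rep + KZ.of Ax1.rep - KZ.of U1.rep) - KZ.of Lbox.rep =
      4 • ((KZ.of Ax1.rep - KZ.of Ax0.rep - KZ.of Ahi.rep) - (KZ.of Ax0.rep - KZ.of E0.rep - KZ.of Bhi.rep)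
        - (KZ.of U1.rep - 2 • KZ.of Ax0.rep) + (KZ.of Ahi.rep - KZ.of Av.rep) - (KZ.of Bm.rep - KZ.of Bv.rep)
        + (KZ.of Bm.rep - KZ.of Bref.rep) + (KZ.of Bref.rep - KZ.of Bhi.rep) + (KZ.of Av.rep - KZ.of MΩ)
        - (KZ.of Bv.rep - KZ.of MΩB) + (KZ.of MΩ - KZ.of MT - KZ.of MΩB))
      - 2 • (KZ.of MQ - KZ.of MT - KZ.of MT') - 2 • (KZ.of MT' - KZ.of MT) - 2 • (KZ.of Lhalf.rep - KZ.of MQ)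
      - (KZ.of Lbox.rep - 2 • KZ.of Lhalf.rep) := by
    abel
  rw [e]
  refine sub_mem (sub_mem (sub_mem (sub_mem (nsmul_mem ?_ 4) (nsmul_mem add_Q 2)) (nsmul_mem T'_cov 2))
    (nsmul_mem Lhalf_cov 2)) Lbox_half
  exact add_mem (sub_mem (add_mem (add_mem (add_mem (sub_mem (add_mem (sub_mem (sub_mem Ax1_split Ax0_split) U1_Ax0)
    Ahi_sq) Bm_sq) Bm_rel) Bref_rel) Av_cov) Bv_cov) add_Ω

end Inv0

/-! ## §6 Euler–Landen at `½` by moves: `[U1] − [U2r] ≡ [Lq]`, `Lq = [□², x/((2−x)(2−xy))]` (`= ½log²2`), `2•[Lq] ≡ [Lbox]`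

Landen's identity `Li₂(x) + Li₂(x/(x−1)) = −½log²(1−x)` on `x ∈ [0,½]` (no singular point on the path) is, written
over the square `(x,s)`, a POINTWISE identity of three rational integrands (`landen_pt`); the end value
`−Li₂(−1)` along the Landen path is the box `W`, congruent to `[U1]` by the Möbius self-map `u = v/(2−v)`
(`rel_moeb`); the `log²` term `Lq` is a half-square triangle of the tensor square `[1/((2−x)(2−w))] ≡ [Lbox]`
(null-edge removal + the degenerate shear `(x,y) ↦ (x,xy)` on `{x>0}` + swap symmetry + additivity). -/
section Landen

open Literature.ModelTheory.ExponentialFields (IsSemialgebraic isSemialgebraic_setOf_eval_le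
  isSemialgebraic_setOf_eval_pos)

/-- Auxiliary definition `U2sDen` (§6): U2s Den. [bookkeeping] -/
def U2sDen : MvPolynomial (Fin 2) ℚ := C 2 - X 0 * X 1
/-- Auxiliary step `U2sDen_pos` (§6): U2s Den pos. [bookkeeping] -/
theorem U2sDen_pos {x : Fin 2 → ℝ} (hx : x ∈ KZ.cube 2) : 0 < aeval x U2sDen := by
  obtain ⟨h0, h1⟩ := cube2 hx
  simp only [map_add, map_sub, map_mul, map_pow, map_neg, aeval_C, aeval_X, map_one, map_ofNat, eq_ratCast, Rat.cast_one, Rat.cast_ofNat, Rat.cast_div, Rat.cast_neg, vec2_0, vec2_1, Matrix.cons_val_zero, Matrix.cons_val_one, Matrix.head_cons, U2sDen]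
  nlinarith [mul_le_one₀ h0.2 h1.1 h1.2]
/-- `[U2s] = [□², 1/(2−xy)] = Li₂(½)`. -/
def U2s : RFun 2 := ⟨1, U2sDen, fun _ hx => (U2sDen_pos hx).ne'⟩

/-- Auxiliary definition `WDen` (§6): WDen. [bookkeeping] -/
def WDen : MvPolynomial (Fin 2) ℚ := (C 2 - X 0) * (C 2 - X 0 * X 1)
/-- Auxiliary step `WDen_pos` (§6): WDen pos. [bookkeeping] -/
theorem WDen_pos {x : Fin 2 → ℝ} (hx : x ∈ KZ.cube 2) : 0 < aeval x WDen := by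
  obtain ⟨h0, h1⟩ := cube2 hx
  simp only [map_add, map_sub, map_mul, map_pow, map_neg, aeval_C, aeval_X, map_one, map_ofNat, eq_ratCast, Rat.cast_one, Rat.cast_ofNat, Rat.cast_div, Rat.cast_neg, vec2_0, vec2_1, Matrix.cons_val_zero, Matrix.cons_val_one, Matrix.head_cons, WDen]
  have : (0 : ℝ) < 2 - x 0 * x 1 := by nlinarith [mul_le_one₀ h0.2 h1.1 h1.2]
  have : (0 : ℝ) < 2 - x 0 := by linarith
  positivity
/-- `W = [□², 2/((2−x)(2−xy))] = −Li₂(−1)` read along the Landen path. -/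
def W : RFun 2 := ⟨C 2, WDen, fun _ hx => (WDen_pos hx).ne'⟩
/-- `Lq = [□², x/((2−x)(2−xy))] = ½log²2`. -/
def Lq : RFun 2 := ⟨X 0, WDen, fun _ hx => (WDen_pos hx).ne'⟩

/-- Auxiliary definition `W'Den` (§6): W'Den. [bookkeeping] -/
def W'Den : MvPolynomial (Fin 2) ℚ := (C 2 - X 0) * (C 2 - X 0 * (C 1 - X 1))
/-- Auxiliary step `W'Den_pos` (§6): W'Den pos. [bookkeeping] -/
theorem W'Den_pos {x : Fin 2 → ℝ} (hx : x ∈ KZ.cube 2) : 0 < aeval x W'Den := by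
  obtain ⟨h0, h1⟩ := cube2 hx
  simp only [map_add, map_sub, map_mul, map_pow, map_neg, aeval_C, aeval_X, map_one, map_ofNat, eq_ratCast, Rat.cast_one, Rat.cast_ofNat, Rat.cast_div, Rat.cast_neg, vec2_0, vec2_1, Matrix.cons_val_zero, Matrix.cons_val_one, Matrix.head_cons, W'Den]
  have : (0 : ℝ) < 2 - x 0 * (1 - x 1) := by nlinarith [mul_le_one₀ h0.2 (by linarith : (0:ℝ) ≤ 1 - x 1) (by linarith : 1 - x 1 ≤ (1:ℝ))]
  have : (0 : ℝ) < 2 - x 0 := by linarith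
  positivity
/-- Auxiliary definition `W'` (§6): W'. [bookkeeping] -/
def W' : RFun 2 := ⟨C 2, W'Den, fun _ hx => (W'Den_pos hx).ne'⟩

/-- Auxiliary step `U2s_rel` (§6): U2s rel. [bookkeeping] -/
theorem U2s_rel : KZ.of U2s.rep - KZ.of U2r.rep ∈ KZ.relations := by
  refine rel_reflect 1 U2r U2s fun x hx => ?_
  obtain ⟨h0, h1⟩ := cube2 hx
  have ha : (0 : ℝ) < 2 - x 0 * x 1 := by nlinarith [mul_le_one₀ h0.2 h1.1 h1.2]
  simp only [U2s, U2r, U2sDen, QU2, RFun.fn, map_add, map_sub, map_mul, map_pow, map_neg, aeval_C, aeval_X, map_one, map_ofNat, eq_ratCast, Rat.cast_one, Rat.cast_ofNat, Rat.cast_div, Rat.cast_neg, vec2_0, vec2_1, Matrix.cons_val_zero, Matrix.cons_val_one, Matrix.head_cons, Function.update_self,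
    Function.update_of_ne (show (0 : Fin 2) ≠ 1 by decide)]
  congr 1
  ring

/-- **Landen, pointwise**: `2/((2−x)(2−xy)) = 1/(2−xy) + x/((2−x)(2−xy))`. -/
theorem landen_pt : KZ.of W.rep - KZ.of U2s.rep - KZ.of Lq.rep ∈ KZ.relations := by
  refine rel_lin W U2s Lq fun x hx => ?_
  obtain ⟨h0, h1⟩ := cube2 hx
  have ha : (0 : ℝ) < 2 - x 0 * x 1 := by nlinarith [mul_le_one₀ h0.2 h1.1 h1.2]
  have hb : (0 : ℝ) < 2 - x 0 := by linarith
  simp only [W, U2s, Lq, WDen, U2sDen, RFun.fn, map_add, map_sub, map_mul, map_pow, map_neg, aeval_C, aeval_X, map_one, map_ofNat, eq_ratCast, Rat.cast_one, Rat.cast_ofNat, Rat.cast_div, Rat.cast_neg, vec2_0, vec2_1, Matrix.cons_val_zero, Matrix.cons_val_one, Matrix.head_cons]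
  field_simp
  ring

/-- Auxiliary step `W'_rel` (§6): W' rel. [bookkeeping] -/
theorem W'_rel : KZ.of W'.rep - KZ.of W.rep ∈ KZ.relations := by
  refine rel_reflect 1 W W' fun x hx => ?_
  simp only [W, W', WDen, W'Den, RFun.fn, map_add, map_sub, map_mul, map_pow, map_neg, aeval_C, aeval_X, map_one, map_ofNat, eq_ratCast, Rat.cast_one, Rat.cast_ofNat, Rat.cast_div, Rat.cast_neg, vec2_0, vec2_1, Matrix.cons_val_zero, Matrix.cons_val_one, Matrix.head_cons, Function.update_self,
    Function.update_of_ne (show (0 : Fin 2) ≠ 1 by decide)]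

end Landen
end Summit.KontsevichZagierPeriods.RootDecompQuadraticDescent.Pair18Homotopy
end
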